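import Literature.NumberTheory.EllipticCurves.ZpExtensionLayersLocalSymbolProofs
import Literature.NumberTheory.EllipticCurves.AnticyclotomicPrimeDecomposition
import Literature.NumberTheory.EllipticCurves.Kato2004.IwasawaH1ReductionInfty
import Literature.NumberTheory.EllipticCurves.HeegnerPoints
import Literature.NumberTheory.GaloisRepresentations.GlobalClassFieldConjugateProofs
import Literature.NumberTheory.GaloisRepresentations.AbsGaloisGroupProofs
import Literature.NumberTheory.GaloisRepresentations.ArtinFormalismInductionProofs
import Literature.NumberTheory.GaloisRepresentations.CyclotomicCharacterArtinNormProofs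
import Literature.NumberTheory.GaloisRepresentations.PadicAlgebraDegreeOnePlace
import Literature.NumberTheory.GaloisRepresentations.LocalKroneckerWeberInertiaProofs
import HarnessLib

/-!
# The local norm residue symbol of `π̄/π` at a split prime fixes the anticyclotomic tower:
# discharge of `ZpExtension.exists_isFrobPow_mem_kerSubgroup_of_isAnticyclotomic`

Topic `NumberTheory/EllipticCurves` (Iwasawa theory of `ℤ_p`-extensions); namespace
`Literature.NumberTheory.EllipticCurves.ZpExtension`.  THEOREMS ONLY (no definition, no named fact,
no instance; D-0026).  Sequel of `ZpExtensionLayersLocalSymbolProofs`.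

Setting: `K` imaginary quadratic with non-trivial automorphism `c`, `p = v v̄` split (`v` of degree
one, `v̄ = c v`), `v^h = (π)`, `k = c(π)/π ∈ Kˣ`; `a_v = canonicalArtin K_v` THE local Artin map
(Deligne's normalisation: geometric Frobenius ↦ uniformiser), `w ∈ W_{K_v}` with `a_v(w) = k`, and
`σ = w ∈ Γ_{K_v}`, i.e. `σ` lifts Serre's norm residue symbol `θ_v(π/π̄) = θ_v(π²/p^h)`.

* §1 Quadratic fields: `Gal(K/ℚ) = {1, c}`, `N(x) = x·c(x) ≥ 0`, `π·c(π) = p^h`; the places above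
  `p` are `v ≠ c v`; valuations of `k`.
* §2 Conjugation by a lift `ρ ∈ Aut_ℚ(K̄)` of `c`: the conjugate `ρ g ρ⁻¹ ∈ Γ_K` of `g ∈ Γ_K`, its
  image `ρ' (res g) ρ'⁻¹` in `Γ_ℚ` with `ρ' ∉ res(Γ_K)` (the shape of `IsAnticyclotomic`), and
  `ρ(ρ⁻¹ L) = L`.
* §3 **Transport of the local symbol** (`smul_eq_of_conjField`): with `M = ρ L`, `v' = c v`, and
  `w' ∈ W_{K_{v'}}` with `a_{v'}(w') = c_*(a_v w)`: `res_{v'}(w')` acts on `M` as `ρ ∘ res_v(w) ∘ ρ⁻¹`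
  (local–global compatibility at `v` and `v'`, `ZpExtensionLayersLocalSymbolProofs` §3, and Tate's
  transport of structure `ψ_{ρL}(c • x) = ρ ψ_L(x) ρ⁻¹`, tree `artinIdeleMap_conjField_smul`).
* §4 **(ii)** `absGaloisRestrict_toAbsGalois_mem_kerSubgroup`: `res_v σ ∈ ker κ` for every
  anticyclotomic `κ`: by the product formula (`…LayersLocalSymbolProofs` §4) `κ(g_v) κ(g_{v̄}) = 1`
  (`g_u = res_u θ_u(k)`), by §3 and anticyclotomicity `κ(g_{v̄}) = κ(ρ g_v⁻¹ ρ⁻¹) = κ(g_v)`, so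
  `κ(g_v)² = 1` in the torsion-free `ℤ_p`.
* §5 **(i)** `deg w = h` (`|k|_v = exp h`) and **(iii)** `ε_p(res_v σ) ≡ m (p^n)` whenever
  `m π² ≡ p^{2h} (v^{n+2h})`: Serre's Theorem 2 in Deligne's normalisation
  (`norm_canonicalArtin_eq_cyclotomicCharacter_mul_zpow`: `N_{K_v/ℚ_p}(a_v w) = ε_p(w) p^{-deg w}`),
  `[K_v : ℚ_p] = 1`, and `p^h c(π)/π = p^{2h}/π²`.
* §6 `exists_isFrobPow_mem_kerSubgroup_of_isAnticyclotomic_holds` (for `K : Type`).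

## References

* J. Tate, *Global class field theory*, Ch. VII of Cassels–Fröhlich (1967), §4.2, Prop. 6.2, Thm. 11.5.
  [CasselsFrohlichANT1967]
* J.-P. Serre, *Local class field theory*, ibid. Ch. VI, §2.4, §3.1 Thm. 2. [SerreLCFT1967]
* D. Brink, *Prime decomposition in the anti-cyclotomic extension*, Math. Comp. 76 (2007), §II Prop. 1.
  [Brink2007]
* J. Neukirch, *Algebraic Number Theory* (1999), Ch. VI (5.6), Ch. VII §6. [NeukirchANT1999]
-/

noncomputable section

open scoped ComplexConjugate
open Field NumberField IsDedekindDomain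

namespace Literature.NumberTheory.EllipticCurves.ZpExtension

open Literature.NumberTheory.GaloisRepresentations Literature.NumberTheory.Automorphic

/-! ### §1. Quadratic fields -/

section Quadratic

variable {K : Type} [Field K] [NumberField K]

/-- `Gal(K/ℚ)` has order `2` for a quadratic field. [folklore] -/
private theorem card_algEquiv (hK2 : Module.finrank ℚ K = 2) : Fintype.card (K ≃ₐ[ℚ] K) = 2 := by
  haveI : Algebra.IsQuadraticExtension ℚ K := ⟨hK2⟩
  rw [← Nat.card_eq_fintype_card, IsGalois.card_aut_eq_finrank, hK2]

/-- **A quadratic field has a non-trivial automorphism.** [folklore] -/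
private theorem exists_algEquiv_ne_one (hK2 : Module.finrank ℚ K = 2) : ∃ c : K ≃ₐ[ℚ] K, c ≠ 1 := by
  by_contra h
  push Not at h
  have h1 : Fintype.card (K ≃ₐ[ℚ] K) ≤ 1 := Fintype.card_le_one_iff.mpr fun a b => by rw [h a, h b]
  rw [card_algEquiv hK2] at h1
  omega

open scoped Classical in
/-- `Gal(K/ℚ) = {1, c}`. [folklore] -/
private theorem univ_eq_pair (hK2 : Module.finrank ℚ K = 2) {c : K ≃ₐ[ℚ] K} (hc : c ≠ 1) :
    (Finset.univ : Finset (K ≃ₐ[ℚ] K)) = {1, c} := by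
  symm
  apply Finset.eq_univ_of_card
  rw [Finset.card_pair (Ne.symm hc), card_algEquiv hK2]

/-- Every automorphism is `1` or `c`. [folklore] -/
private theorem eq_one_or_eq (hK2 : Module.finrank ℚ K = 2) {c : K ≃ₐ[ℚ] K} (hc : c ≠ 1)
    (σ : K ≃ₐ[ℚ] K) : σ = 1 ∨ σ = c := by
  classical
  have h : σ ∈ (Finset.univ : Finset (K ≃ₐ[ℚ] K)) := Finset.mem_univ σ
  rw [univ_eq_pair hK2 hc, Finset.mem_insert, Finset.mem_singleton] at h
  exact h

/-- `c² = 1`. [folklore] -/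
private theorem algEquiv_mul_self (hK2 : Module.finrank ℚ K = 2) (c : K ≃ₐ[ℚ] K) : c * c = 1 := by
  have h : c ^ Nat.card (K ≃ₐ[ℚ] K) = 1 := pow_card_eq_one'
  rwa [Nat.card_eq_fintype_card, card_algEquiv hK2, pow_two] at h

/-- `c (c x) = x`. [folklore] -/
private theorem algEquiv_algEquiv_apply (hK2 : Module.finrank ℚ K = 2) (c : K ≃ₐ[ℚ] K) (x : K) :
    c (c x) = x := by
  have h := congrArg (fun τ : K ≃ₐ[ℚ] K => τ x) (algEquiv_mul_self hK2 c)
  simpa using h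

/-- **`N(x) = x · c(x)`** in a quadratic field (Mathlib `Algebra.norm_eq_prod_automorphisms`).
[folklore] -/
private theorem algebraMap_norm_eq_mul (hK2 : Module.finrank ℚ K = 2) {c : K ≃ₐ[ℚ] K} (hc : c ≠ 1)
    (x : K) : algebraMap ℚ K (Algebra.norm ℚ x) = x * c x := by
  classical
  haveI : Algebra.IsQuadraticExtension ℚ K := ⟨hK2⟩
  rw [Algebra.norm_eq_prod_automorphisms ℚ x, univ_eq_pair hK2 hc, Finset.prod_pair (Ne.symm hc),
    AlgEquiv.one_apply]

/-- An imaginary quadratic field has exactly one infinite place. [folklore] -/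
private theorem subsingleton_infinitePlace (hK : IsImaginaryQuadratic K) :
    Subsingleton (InfinitePlace K) := by
  haveI : IsTotallyComplex K := hK.2
  apply Fintype.card_le_one_iff_subsingleton.mp
  rw [InfinitePlace.card_eq_nrRealPlaces_add_nrComplexPlaces, IsTotallyComplex.nrRealPlaces_eq_zero K,
    nrComplexPlaces_eq_one_of_finrank_eq_two hK.1 hK.2.isComplex]

/-- **`φ(c x) = conj(φ x)`** for every complex embedding `φ` of an imaginary quadratic field and its
non-trivial automorphism `c` (one infinite place; `φ ∘ c ≠ φ`). [folklore] -/
private theorem embedding_comp_algEquiv (hK : IsImaginaryQuadratic K) {c : K ≃ₐ[ℚ] K} (hc : c ≠ 1)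
    (φ : K →+* ℂ) (x : K) : φ (c x) = conj (φ x) := by
  haveI := subsingleton_infinitePlace hK
  set ψ : K →+* ℂ := φ.comp c.toRingEquiv.toRingHom with hψ
  have hmk : InfinitePlace.mk ψ = InfinitePlace.mk φ := Subsingleton.elim _ _
  rcases InfinitePlace.mk_eq_iff.mp hmk with h | h
  · exfalso; apply hc
    ext y
    exact φ.injective (by simpa [hψ] using congrArg (fun f : K →+* ℂ => f y) h)
  · have hy := congrArg (fun f : K →+* ℂ => f x) h
    simp only [hψ, ComplexEmbedding.conjugate_coe_eq, RingHom.coe_comp, Function.comp_apply] at hy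
    rw [← hy, Complex.conj_conj]
    rfl

/-- **`N(x) ≥ 0` on an imaginary quadratic field** (`φ(N x) = |φ x|²`). [folklore] -/
private theorem norm_nonneg (hK : IsImaginaryQuadratic K) (x : K) : 0 ≤ Algebra.norm ℚ x := by
  obtain ⟨c, hc⟩ := exists_algEquiv_ne_one hK.1
  set φ : K →+* ℂ := (Classical.arbitrary (InfinitePlace K)).embedding with hφ
  have h1 : (φ (algebraMap ℚ K (Algebra.norm ℚ x)) : ℂ) = ((Algebra.norm ℚ x : ℚ) : ℂ) := by
    rw [eq_ratCast, map_ratCast]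
  have h2 : φ (algebraMap ℚ K (Algebra.norm ℚ x)) = (Complex.normSq (φ x) : ℂ) := by
    rw [algebraMap_norm_eq_mul hK.1 hc, map_mul, embedding_comp_algEquiv hK hc, Complex.mul_conj]
  have h3 : ((Algebra.norm ℚ x : ℚ) : ℂ) = (Complex.normSq (φ x) : ℂ) := by rw [← h2, h1]
  have h4 : ((Algebra.norm ℚ x : ℚ) : ℝ) = Complex.normSq (φ x) := by exact_mod_cast h3
  have h5 : (0 : ℝ) ≤ ((Algebra.norm ℚ x : ℚ) : ℝ) := h4 ▸ Complex.normSq_nonneg _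
  exact_mod_cast h5

/-- `N v = p` for a place `v` of residue degree one above the rational prime `p`. [folklore] -/
private theorem absNorm_eq_of_inertiaDeg_eq_one {p : ℕ} [Fact p.Prime] {v : HeightOneSpectrum (𝓞 K)}
    (hpv : ((p : ℕ) : 𝓞 K) ∈ v.asIdeal) (hf : v.asIdeal.inertiaDeg (𝓞 ℚ) = 1) :
    Ideal.absNorm v.asIdeal = p := by
  have h := residueCard_eq_pow_inertiaDeg_of_under_eq (K := ℚ) (M := K) (v := v.under (𝓞 ℚ))
    (w := v) (HeightOneSpectrum.under_asIdeal (𝓞 ℚ) v).symm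
  rw [hf, pow_one, Rat.residueCard_eq_natGenerator,
    LocalField.natGenerator_eq_of_natCast_mem p _ (LocalField.natCast_mem_under p v hpv)] at h
  exact h

/-- **`π · c(π) = p^h`** when `v^h = (π)` at a place `v` of degree one above `p` in an imaginary
quadratic field: `N(π) = ± N(v)^h = ± p^h` and `N ≥ 0`. [folklore] -/
private theorem mul_algEquiv_eq_pow_of_pow_eq_span (hK : IsImaginaryQuadratic K) {c : K ≃ₐ[ℚ] K} (hc : c ≠ 1)
    {p : ℕ} [Fact p.Prime] {v : HeightOneSpectrum (𝓞 K)} (hpv : ((p : ℕ) : 𝓞 K) ∈ v.asIdeal)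
    (hf : v.asIdeal.inertiaDeg (𝓞 ℚ) = 1) {h : ℕ} {π : 𝓞 K} (hπ : v.asIdeal ^ h = Ideal.span {π}) :
    (π : K) * c π = (p : K) ^ h := by
  -- `|N π| = N((π)) = N(v)^h = p^h`
  have habs : (Algebra.norm ℤ π).natAbs = p ^ h := by
    rw [← Ideal.absNorm_span_singleton, ← hπ, map_pow, absNorm_eq_of_inertiaDeg_eq_one hpv hf]
  have hnn : 0 ≤ Algebra.norm ℤ π := by
    have h0 := norm_nonneg hK (π : K)
    rw [← Algebra.coe_norm_int] at h0
    exact_mod_cast h0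
  have hnorm : Algebra.norm ℤ π = (p : ℤ) ^ h := by
    rw [← Int.natAbs_of_nonneg hnn, habs]; push_cast; rfl
  have h1 := algebraMap_norm_eq_mul hK.1 hc (π : K)
  rw [← Algebra.coe_norm_int, hnorm] at h1
  rw [← h1]; push_cast; rfl

end Quadratic

/-! ### §1b. The two places above a split prime, and the valuations of `k = c(π)/π` -/

section Places

variable {K : Type} [Field K] [NumberField K] {p : ℕ} [Fact p.Prime]

omit [Fact p.Prime] in
/-- **A place of degree one above `p` in a quadratic field is moved by the non-trivial
automorphism**: `∑_{u ∣ p} e_u f_u = 2` with `e_v f_v = 1` leaves a second place, which is `c v` by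
transitivity of `Gal(K/ℚ)` on the places above `p`. [folklore] -/
private theorem smul_ne_self_of_degree_one (hK2 : Module.finrank ℚ K = 2) {c : K ≃ₐ[ℚ] K} (hc : c ≠ 1)
    {v : HeightOneSpectrum (𝓞 K)}
    (he : v.asIdeal.ramificationIdx (𝓞 ℚ) = 1) (hf : v.asIdeal.inertiaDeg (𝓞 ℚ) = 1) :
    c • v ≠ v := by
  classical
  haveI : Algebra.IsQuadraticExtension ℚ K := ⟨hK2⟩
  intro hcv
  -- every place above `(p)` is `v`
  set P : Ideal (𝓞 ℚ) := (v.under (𝓞 ℚ)).asIdeal with hP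
  haveI hPmax : P.IsMaximal := (v.under (𝓞 ℚ)).isMaximal
  have hall : ∀ 𝔓 : P.primesOver (𝓞 K), (𝔓 : Ideal (𝓞 K)) = v.asIdeal := by
    intro 𝔓
    have h𝔓ne : (𝔓 : Ideal (𝓞 K)) ≠ ⊥ := by
      haveI : (𝔓 : Ideal (𝓞 K)).IsPrime := 𝔓.2.1
      haveI : (𝔓 : Ideal (𝓞 K)).LiesOver P := 𝔓.2.2
      exact Ideal.ne_bot_of_liesOver_of_ne_bot (Ring.ne_bot_of_isMaximal_of_not_isField hPmax
        (RingOfIntegers.not_isField ℚ)) (𝔓 : Ideal (𝓞 K))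
    set u : HeightOneSpectrum (𝓞 K) := ⟨𝔓, 𝔓.2.1, h𝔓ne⟩ with hu
    have huv : u.under (𝓞 ℚ) = v.under (𝓞 ℚ) := by
      apply HeightOneSpectrum.ext
      rw [HeightOneSpectrum.under_asIdeal, HeightOneSpectrum.under_asIdeal]
      exact 𝔓.2.2.over.symm
    obtain ⟨σ, hσ⟩ := HeightOneSpectrum.exists_algEquiv_smul_eq (F := ℚ) (huv.symm)
    rcases eq_one_or_eq hK2 hc σ with rfl | rfl
    · rw [one_smul] at hσ; exact congrArg HeightOneSpectrum.asIdeal hσ.symm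
    · rw [hcv] at hσ; exact congrArg HeightOneSpectrum.asIdeal hσ.symm
  -- so the fundamental identity has a single term `e_v f_v = 1 ≠ 2`
  have hsum := NumberFields.sum_ramificationIdx_mul_inertiaDeg_eq_finrank_of_isMaximal ℚ K P
  rw [Algebra.IsQuadraticExtension.finrank_eq_two] at hsum
  have hv : v.asIdeal ∈ P.primesOver (𝓞 K) :=
    ⟨v.isPrime, ⟨(HeightOneSpectrum.under_asIdeal (𝓞 ℚ) v).symm⟩⟩
  haveI : Subsingleton (P.primesOver (𝓞 K)) := ⟨fun a b => Subtype.ext ((hall a).trans (hall b).symm)⟩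
  letI : Unique (P.primesOver (𝓞 K)) := uniqueOfSubsingleton ⟨v.asIdeal, hv⟩
  rw [Fintype.sum_unique] at hsum
  change v.asIdeal.ramificationIdx (𝓞 ℚ) * v.asIdeal.inertiaDeg (𝓞 ℚ) = 2 at hsum
  rw [he, hf] at hsum
  exact absurd hsum (by norm_num)

/-- The places above a split `p` of a quadratic field are `v` and `c v`. [folklore] -/
private theorem eq_or_eq_smul_of_natCast_mem (hK2 : Module.finrank ℚ K = 2) {c : K ≃ₐ[ℚ] K}
    {v : HeightOneSpectrum (𝓞 K)} (hcv : c • v ≠ v) (hpv : ((p : ℕ) : 𝓞 K) ∈ v.asIdeal)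
    {u : HeightOneSpectrum (𝓞 K)} (hpu : ((p : ℕ) : 𝓞 K) ∈ u.asIdeal) : u = v ∨ u = c • v := by
  haveI : Algebra.IsQuadraticExtension ℚ K := ⟨hK2⟩
  have hpcv : ((p : ℕ) : 𝓞 K) ∈ (c • v).asIdeal := by
    have := (HeightOneSpectrum.smul_mem_smul_asIdeal_iff c v ((p : ℕ) : 𝓞 K)).mpr hpv
    rwa [show c • ((p : ℕ) : 𝓞 K) = (p : 𝓞 K) from map_natCast (MulSemiringAction.toRingHom _ _ c) p]
      at this
  exact (LocalField.ramificationIdx_eq_one_and_inertiaDeg_eq_one_of_ne p v (c • v) hcv.symm hpv hpcv).2 u hpu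

/-- `v(π) = exp (-h)` at `v` when `v^h = (π)`. [folklore] -/
private theorem valuation_eq_exp_neg_of_pow_eq_span {v : HeightOneSpectrum (𝓞 K)} {h : ℕ} {π : 𝓞 K}
    (hπ : v.asIdeal ^ h = Ideal.span {π}) :
    v.valuation K (π : K) = WithZero.exp (-(h : ℤ)) := by
  have hπ0 : π ≠ 0 := by
    intro h0
    rw [h0, Ideal.span_singleton_zero] at hπ
    exact pow_ne_zero h v.ne_bot hπ
  rw [HeightOneSpectrum.valuation_of_algebraMap, HeightOneSpectrum.intValuation_if_neg _ hπ0, ← hπ,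
    Associates.mk_pow, Associates.count_pow (Associates.mk_ne_zero.mpr v.ne_bot) v.associates_irreducible,
    Associates.count_self v.associates_irreducible, mul_one]

/-- `w(π) = 1` at every `w ≠ v` when `v^h = (π)`. [folklore] -/
private theorem valuation_eq_one_of_pow_eq_span {v w : HeightOneSpectrum (𝓞 K)} (hwv : w ≠ v) {h : ℕ}
    {π : 𝓞 K} (hπ : v.asIdeal ^ h = Ideal.span {π}) : w.valuation K (π : K) = 1 := by
  have hπ0 : π ≠ 0 := by
    intro h0
    rw [h0, Ideal.span_singleton_zero] at hπ
    exact pow_ne_zero h v.ne_bot hπ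
  rw [HeightOneSpectrum.valuation_of_algebraMap]
  refine le_antisymm (HeightOneSpectrum.intValuation_le_one w π) ?_
  by_contra hlt
  rw [not_le, HeightOneSpectrum.intValuation_lt_one_iff_dvd, ← hπ] at hlt
  have h1 : w.asIdeal ∣ v.asIdeal := w.irreducible.prime.dvd_of_dvd_pow hlt
  have h2 : v.asIdeal = w.asIdeal := v.isMaximal.eq_of_le w.isPrime.ne_top (Ideal.dvd_iff_le.mp h1)
  exact hwv (HeightOneSpectrum.ext h2.symm)

end Places

/-- `k = c(π)/π` is a unit away from `v` and `c v`. [folklore] -/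
private theorem valuation_div_eq_one {K : Type} [Field K] [NumberField K]
    (c : K ≃ₐ[ℚ] K) {v u : HeightOneSpectrum (𝓞 K)} (huv : u ≠ v) (hucv : u ≠ c • v)
    {h : ℕ} {π : 𝓞 K} (hπ : v.asIdeal ^ h = Ideal.span {π}) :
    u.valuation K (c (π : K) / (π : K)) = 1 := by
  have h1 : u.valuation K (π : K) = 1 := valuation_eq_one_of_pow_eq_span huv hπ
  have h2 : u.valuation K (c (π : K)) = 1 := by
    have hu : c • (c⁻¹ • u) = u := smul_inv_smul c u
    have h3 := HeightOneSpectrum.valuation_algEquiv_smul (F := ℚ) c (c⁻¹ • u) (π : K)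
    rw [hu] at h3
    rw [h3]
    exact valuation_eq_one_of_pow_eq_span (fun h' => hucv (by rw [← h', smul_inv_smul])) hπ
  rw [map_div₀, h1, h2, div_one]

/-- `|k|_v = exp h` at `v` for `k = c(π)/π`, `v^h = (π)`, `c v ≠ v`. [folklore] -/
private theorem valuation_div_eq_exp {K : Type} [Field K] [NumberField K]
    (c : K ≃ₐ[ℚ] K) {v : HeightOneSpectrum (𝓞 K)} (hcv : c • v ≠ v)
    {h : ℕ} {π : 𝓞 K} (hπ : v.asIdeal ^ h = Ideal.span {π}) :
    v.valuation K (c (π : K) / (π : K)) = WithZero.exp (h : ℤ) := by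
  have h1 : v.valuation K (π : K) = WithZero.exp (-(h : ℤ)) := valuation_eq_exp_neg_of_pow_eq_span hπ
  have h2 : v.valuation K (c (π : K)) = 1 := by
    have hu : c • (c⁻¹ • v) = v := smul_inv_smul c v
    have h3 := HeightOneSpectrum.valuation_algEquiv_smul (F := ℚ) c (c⁻¹ • v) (π : K)
    rw [hu] at h3
    rw [h3]
    refine valuation_eq_one_of_pow_eq_span (fun h' => hcv ?_) hπ
    have h'' := congrArg (fun u => c • u) h'
    simp only [smul_inv_smul] at h''
    exact h''.symm
  rw [map_div₀, h1, h2, one_div, ← WithZero.exp_neg, neg_neg]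

/-! ### §2. Conjugation by a lift of an automorphism of `K` to `K̄` -/

section Conj

variable {F : Type} [Field F] {K : Type} [Field K] [Algebra F K]

/-- **Lifting an automorphism of a normal `K/F` to `K̄`.** [folklore] -/
private theorem exists_algEquiv_restrictNormal_eq [Normal F K] (c : K ≃ₐ[F] K) :
    ∃ ρ : AlgebraicClosure K ≃ₐ[F] AlgebraicClosure K, ρ.restrictNormal K = c := by
  haveI : Algebra.IsAlgebraic F (AlgebraicClosure K) := Algebra.IsAlgebraic.trans F K (AlgebraicClosure K)
  haveI : Normal F (AlgebraicClosure K) := ⟨fun x => IsAlgClosed.splits _⟩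
  refine ⟨AlgEquiv.liftNormal c (AlgebraicClosure K), AlgEquiv.ext fun a =>
    (algebraMap K (AlgebraicClosure K)).injective ?_⟩
  rw [AlgEquiv.restrictNormal_commutes, AlgEquiv.liftNormal_commutes]

/-- **The conjugate `ρ g ρ⁻¹ ∈ Γ_K`** of `g ∈ Γ_K` by `ρ ∈ Aut_F(K̄)` (it is again `K`-linear, `ρ`
restricting to an automorphism of the normal `K/F`). [folklore] -/
private theorem exists_smul_eq_conj [Normal F K] (ρ : AlgebraicClosure K ≃ₐ[F] AlgebraicClosure K)
    (g : absoluteGaloisGroup K) :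
    ∃ τ : absoluteGaloisGroup K, ∀ x : AlgebraicClosure K, τ • x = ρ (g • ρ.symm x) := by
  let e : AlgebraicClosure K ≃+* AlgebraicClosure K :=
    ρ.symm.toRingEquiv.trans (((absoluteGaloisGroup.toAlgEquiv K g).toRingEquiv).trans ρ.toRingEquiv)
  have he : ∀ x, e x = ρ (g • ρ.symm x) := fun x => rfl
  have hsymm : ∀ a : K, ρ.symm (algebraMap K (AlgebraicClosure K) a) =
      algebraMap K (AlgebraicClosure K) ((ρ.restrictNormal K).symm a) := by
    intro a
    apply ρ.injective
    rw [AlgEquiv.apply_symm_apply, ← AlgEquiv.restrictNormal_commutes, AlgEquiv.apply_symm_apply]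
  have hcomm : ∀ a : K, e (algebraMap K (AlgebraicClosure K) a) = algebraMap K (AlgebraicClosure K) a := by
    intro a
    rw [he, hsymm, absoluteGaloisGroup.smul_def, AlgEquiv.commutes, ← AlgEquiv.restrictNormal_commutes,
      AlgEquiv.apply_symm_apply]
  refine ⟨(absoluteGaloisGroup.toAlgEquiv K).symm (AlgEquiv.ofRingEquiv (f := e) hcomm), fun x => ?_⟩
  rw [absoluteGaloisGroup.toAlgEquiv_symm_apply]
  exact he x

/-- **The image of `ρ g ρ⁻¹` in `Γ_F` is `ρ' (res g) ρ'⁻¹` with `ρ' ∉ res(Γ_K)`** when `ρ|_K ≠ 1`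
(`ρ' = ι⁻¹ ρ ι` for the identification `ι : F̄ ≅ K̄` along which `res : Γ_K → Γ_F` is defined) — the
shape of the hypothesis of `ZpExtension.IsAnticyclotomic`. [folklore] -/
private theorem exists_not_mem_range_conj [Normal F K]
    (ρ : AlgebraicClosure K ≃ₐ[F] AlgebraicClosure K) (hρ : ρ.restrictNormal K ≠ 1) :
    ∃ ρ' : absoluteGaloisGroup F, ρ' ∉ Set.range (absGaloisRestrict F K) ∧
      ∀ g τ : absoluteGaloisGroup K, (∀ x : AlgebraicClosure K, τ • x = ρ (g • ρ.symm x)) →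
        absGaloisRestrict F K τ = ρ' * absGaloisRestrict F K g * ρ'⁻¹ := by
  set ιe := absClosureEquiv F K with hιe_def
  have hιe : ∀ y, ιe y = absClosureEmbedding F K y := fun _ => rfl
  -- `ρ' = ιe⁻¹ ∘ ρ ∘ ιe`
  let ρ' : absoluteGaloisGroup F := (absoluteGaloisGroup.toAlgEquiv F).symm ((ιe.trans ρ).trans ιe.symm)
  have hρ' : ∀ y : AlgebraicClosure F, ρ' • y = ιe.symm (ρ (ιe y)) := fun y => rfl
  have hρ'inv : ∀ y : AlgebraicClosure F, ρ'⁻¹ • y = ιe.symm (ρ.symm (ιe y)) := by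
    intro y
    rw [inv_smul_eq_iff, hρ', AlgEquiv.apply_symm_apply, AlgEquiv.apply_symm_apply,
      AlgEquiv.symm_apply_apply]
  -- `res` along `ιe`
  have hres : ∀ (σ : absoluteGaloisGroup K) (y : AlgebraicClosure F),
      absGaloisRestrict F K σ • y = ιe.symm (σ • ιe y) := by
    intro σ y
    apply ιe.injective
    rw [AlgEquiv.apply_symm_apply, hιe, absGaloisRestrict_apply_smul, hιe]
  refine ⟨ρ', ?_, fun g τ hτ => ?_⟩
  · rintro ⟨σ₀, hσ₀⟩
    apply hρ
    -- `ρ = σ₀` on `K̄`, so `ρ` fixes `K`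
    have hρσ : ∀ x : AlgebraicClosure K, ρ x = σ₀ • x := by
      intro x
      have h1 := hres σ₀ (ιe.symm x)
      rw [hσ₀, hρ', AlgEquiv.apply_symm_apply] at h1
      exact ιe.symm.injective (by rw [h1])
    refine AlgEquiv.ext fun a => (algebraMap K (AlgebraicClosure K)).injective ?_
    rw [AlgEquiv.restrictNormal_commutes, hρσ, absoluteGaloisGroup.smul_def, AlgEquiv.commutes,
      AlgEquiv.one_apply]
  · apply FaithfulSMul.eq_of_smul_eq_smul (α := AlgebraicClosure F)
    intro y
    rw [hres, hτ, mul_smul, mul_smul, hρ'inv, hres, AlgEquiv.apply_symm_apply, hρ',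
      AlgEquiv.apply_symm_apply]

/-- `ρ (ρ⁻¹ M) = M`. [folklore] -/
private theorem conjField_conjField_symm [IsGalois F K] (ρ : AlgebraicClosure K ≃ₐ[F] AlgebraicClosure K)
    (M : IntermediateField K (AlgebraicClosure K)) : conjField ρ (conjField ρ.symm M) = M := by
  refine IntermediateField.ext fun x => ⟨fun hx => ?_, fun hx => ?_⟩
  · obtain ⟨y, hy, rfl⟩ := mem_conjField_iff.mp hx
    obtain ⟨z, hz, rfl⟩ := mem_conjField_iff.mp hy
    rw [AlgEquiv.apply_symm_apply]; exact hz
  · exact mem_conjField_iff.mpr ⟨ρ.symm x, mem_conjField_iff.mpr ⟨x, hx, rfl⟩, ρ.apply_symm_apply x⟩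

/-- Galois transport of a global unit to the completions: `σ_*(x_w) = (σ x)_{σ w}`. [folklore] -/
private theorem galAdicCompletionUnitsEquiv_globalToLocalUnits [NumberField K] (σ : K ≃ₐ[F] K)
    {w w' : HeightOneSpectrum (𝓞 K)} (hw : σ • w = w') (x : Kˣ) :
    galAdicCompletionUnitsEquiv (L := K) σ hw (globalToLocalUnits w x) =
      globalToLocalUnits w' (Units.map (σ : K →* K) x) := by
  subst hw
  refine Units.ext ?_
  change galAdicCompletionEquiv (L := K) σ rfl (algebraMap K (w.adicCompletion K) (x : K)) =
    algebraMap K ((σ • w).adicCompletion K) (σ (x : K))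
  exact galAdicCompletionMap_coe_algEquiv F σ rfl (x : K)

end Conj

/-! ### §3. Transport of the local symbol under `ρ` -/

section Transport

variable {F : Type} [Field F] {K : Type} [Field K] [Algebra F K] [NumberField K] [IsGalois F K]
  [FiniteDimensional F K]

/-- **Transport of the local symbol.**  Let `ρ ∈ Aut_F(K̄)` restrict to `σ` on `K`, `L ⊆ K̄` be
finite abelian over `K` with conjugate `M = ρ L`, `v` a finite place with `σ v = v'`,
`w ∈ W_{K_v}` and `w' ∈ W_{K_{v'}}` with `a_{v'}(w') = σ_*(a_v(w))` (THE local Artin maps).  Then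
`res_{v'}(w')` acts on `M` as `ρ ∘ res_v(w) ∘ ρ⁻¹`: both restrict on `M` to
`ψ_M(ι_{v'}(σ_* a_v w))⁻¹ = ρ ψ_L(ι_v(a_v w))⁻¹ ρ⁻¹` (local–global compatibility at `v'` and at `v`,
Neukirch VI (5.6), and `ψ_{ρL}(σ • x) = ρ ψ_L(x) ρ⁻¹`, Tate VII 11.5).
[cite: CasselsFrohlichANT1967, Ch. VII §6 Prop. 6.2 and Thm. 11.5] [cite: NeukirchANT1999, Ch. VI §5 Prop. (5.6)] -/
theorem smul_eq_of_mem_conjField (ρ : AlgebraicClosure K ≃ₐ[F] AlgebraicClosure K)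
    (L : IntermediateField K (AlgebraicClosure K)) [FiniteDimensional K L] [IsAbelianGalois K L]
    [NumberField L] {v v' : HeightOneSpectrum (𝓞 K)} (hv' : ρ.restrictNormal K • v = v')
    {w : WeilGroup (v.adicCompletion K)} {w' : WeilGroup (v'.adicCompletion K)}
    (hw' : canonicalArtin (v'.adicCompletion K) w' =
      galAdicCompletionUnitsEquiv (L := K) (ρ.restrictNormal K) hv' (canonicalArtin (v.adicCompletion K) w))
    {x : AlgebraicClosure K} (hx : x ∈ conjField ρ L) :
    absGaloisRestrict K (v'.adicCompletion K) (WeilGroup.toAbsGalois (v'.adicCompletion K) w') • x =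
      ρ (absGaloisRestrict K (v.adicCompletion K) (WeilGroup.toAbsGalois (v.adicCompletion K) w) •
        ρ.symm x) := by
  subst hv'
  -- local–global compatibility at `σ v` for `M = ρ L`, transported from `v` and `L`
  have h1 := ArtinLocalGlobal.absRestrictNormalHom_absGaloisRestrict_toAbsGalois_eq_inv
    (ρ.restrictNormal K • v) (conjField ρ L)
    (isLocalArtinMap_canonicalArtin_holds ((ρ.restrictNormal K • v).adicCompletion K)) w'
  have hinv : ∀ a : L ≃ₐ[K] L,
      (semilinearConj (conjFieldEquiv ρ L) (ρ.restrictNormal K) (conjFieldEquiv_semilinear ρ L) a)⁻¹ =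
        semilinearConj (conjFieldEquiv ρ L) (ρ.restrictNormal K) (conjFieldEquiv_semilinear ρ L) a⁻¹ :=
    fun a => by rw [← semilinearConjHom_apply, ← semilinearConjHom_apply, map_inv]
  rw [hw', ← algEquiv_smul_localUnits F K (ρ.restrictNormal K) v, artinIdeleMap_conjField_smul L
      artinReciprocity_character_holds ρ, hinv,
    ← ArtinLocalGlobal.absRestrictNormalHom_absGaloisRestrict_toAbsGalois_eq_inv v L
      (isLocalArtinMap_canonicalArtin_holds (v.adicCompletion K)) w] at h1
  -- evaluate at `x ∈ ρ L`
  have h2 := congrArg (fun f : conjField ρ L ≃ₐ[K] conjField ρ L =>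
    ((f ⟨x, hx⟩ : conjField ρ L) : AlgebraicClosure K)) h1
  rw [ArtinLocalGlobal.coe_absRestrictNormalHom_apply, semilinearConj_apply, coe_conjFieldEquiv_apply,
    ArtinLocalGlobal.coe_absRestrictNormalHom_apply] at h2
  rw [h2]
  rfl

end Transport

/-! ### §4. (ii) The local symbol of `c(π)/π` fixes every anticyclotomic `ℤ_p`-extension -/

section Anticyclotomic

variable {K : Type} [Field K] [NumberField K] {p : ℕ} [Fact p.Prime]

/-- **(ii) `res_v θ_v(π̄/π) ∈ Gal(K̄/K_∞)` for every anticyclotomic `K_∞`.**  Let `K` be imaginary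
quadratic with non-trivial automorphism `c`, `v` a place of degree one above `p` (so `p = v·cv`
splits), `v^h = (π)`, `k = c(π)/π`, and `w ∈ W_{K_v}` with `a_v(w) = k` (THE local Artin map of
`K_v`).  Then `res_v(w) ∈ ker κ` for every anticyclotomic `ℤ_p`-extension `κ` of `K`.  Proof: with
`g = res_v(w)` and `ḡ = res_{cv}(w̄)`, `a_{cv}(w̄) = k`: (1) `κ(g ḡ) = 1` — on every layer `K_n`,
`g ḡ` restricts to `(ψ(ι_v k) ψ(ι_{cv} k))⁻¹ = 1` (product formula,
`artinIdeleMap_localUnits_mul_eq_one_of_pair`; `K_n` is unramified outside `p`, `k` is a unit outside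
`p`); (2) `κ(ḡ) = κ(ρ g⁻¹ ρ⁻¹) = κ(g)` for a lift `ρ` of `c` — `ḡ` and `ρ g⁻¹ ρ⁻¹` agree on every
layer by `smul_eq_of_mem_conjField` (`c_*(k⁻¹) = k` as `c² = 1`), and `ρ` acts on `κ` by `-1`
(`IsAnticyclotomic`, Brink §II Prop. 1); (3) `κ(g)² = 1` in the torsion-free `ℤ_p`.
[cite: CasselsFrohlichANT1967, Ch. VII §6 Prop. 6.2, §4.2 (ii)] [cite: Brink2007, §II Prop. 1 (p. 2130)] -/
theorem absGaloisRestrict_toAbsGalois_mem_kerSubgroup (hK : IsImaginaryQuadratic K) {c : K ≃ₐ[ℚ] K}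
    (hc : c ≠ 1) (κ : ZpExtension K p) (hκ : κ.IsAnticyclotomic) {v : HeightOneSpectrum (𝓞 K)}
    (hpv : ((p : ℕ) : 𝓞 K) ∈ v.asIdeal) (he : v.asIdeal.ramificationIdx (𝓞 ℚ) = 1)
    (hf : v.asIdeal.inertiaDeg (𝓞 ℚ) = 1) {h : ℕ} {π : 𝓞 K} (hπ : v.asIdeal ^ h = Ideal.span {π})
    {k : Kˣ} (hk : (k : K) = c (π : K) / (π : K)) {w : WeilGroup (v.adicCompletion K)}
    (hw : canonicalArtin (v.adicCompletion K) w = globalToLocalUnits v k) :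
    absGaloisRestrict K (v.adicCompletion K) (WeilGroup.toAbsGalois (v.adicCompletion K) w) ∈
      κ.kerSubgroup := by
  classical
  haveI : Algebra.IsQuadraticExtension ℚ K := ⟨hK.1⟩
  haveI : IsGalois ℚ K := inferInstance
  have hcv : c • v ≠ v := smul_ne_self_of_degree_one hK.1 hc he hf
  -- `k` is a unit outside `{v, cv}`, and the layers are unramified there
  have hkval : ∀ u : HeightOneSpectrum (𝓞 K), u ≠ v → u ≠ c • v → u.valuation K (k : K) = 1 := by
    intro u huv hucv
    rw [hk]; exact valuation_div_eq_one c huv hucv hπ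
  have hunr : ∀ (n : ℕ) (u : HeightOneSpectrum (𝓞 K)), u ≠ v → u ≠ c • v →
      Algebra.IsUnramifiedIn (𝓞 (κ.layer n)) u.asIdeal := by
    intro n u huv hucv
    refine κ.isUnramifiedIn_layer_of_not_mem n fun hpu => ?_
    rcases eq_or_eq_smul_of_natCast_mem hK.1 hcv hpv hpu with h' | h'
    · exact huv h'
    · exact hucv h'
  -- the companion symbol at `cv`
  obtain ⟨wbar, hwbar⟩ :=
    (isLocalArtinMap_canonicalArtin_holds ((c • v).adicCompletion K)).isOpenQuotientMap_artin.surjective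
      (globalToLocalUnits (c • v) k)
  set g := absGaloisRestrict K (v.adicCompletion K) (WeilGroup.toAbsGalois (v.adicCompletion K) w) with hg
  set gbar := absGaloisRestrict K ((c • v).adicCompletion K)
    (WeilGroup.toAbsGalois ((c • v).adicCompletion K) wbar) with hgbar
  -- (1) product formula: `κ (g * ḡ) = 1`
  have hS1 : g * gbar ∈ κ.kerSubgroup := by
    refine κ.mem_kerSubgroup_of_forall_mem_layerSubgroup fun n => ?_
    haveI : FiniteDimensional K (κ.layer n) := κ.finiteDimensional_layer_holds n
    haveI : IsGalois K (κ.layer n) := κ.isGalois_layer_holds n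
    haveI : IsAbelianGalois K (κ.layer n) := κ.isAbelianGalois_layer n
    haveI : NumberField (κ.layer n) := NumberField.of_module_finite K _
    rw [← κ.absRestrictNormalHom_layer_eq_one_iff n, map_mul, hg, hgbar,
      ArtinLocalGlobal.absRestrictNormalHom_absGaloisRestrict_toAbsGalois_eq_inv v (κ.layer n)
        (isLocalArtinMap_canonicalArtin_holds _) w,
      ArtinLocalGlobal.absRestrictNormalHom_absGaloisRestrict_toAbsGalois_eq_inv (c • v) (κ.layer n)
        (isLocalArtinMap_canonicalArtin_holds _) wbar, hw, hwbar, ← mul_inv_rev,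
      IsMulCommutative.is_comm.comm (artinIdeleMap (κ.layer n) _ _),
      artinIdeleMap_localUnits_mul_eq_one_of_pair (κ.layer n) hK.2.isComplex hcv.symm (hunr n) k hkval,
      inv_one]
  -- (2) the lift `ρ` of `c` and the conjugate `τ = ρ g⁻¹ ρ⁻¹`
  obtain ⟨ρ, hρK⟩ := exists_algEquiv_restrictNormal_eq (F := ℚ) c
  obtain ⟨τ, hτ⟩ := exists_smul_eq_conj ρ g⁻¹
  obtain ⟨ρ', hρ'r, hρ'c⟩ := exists_not_mem_range_conj ρ (by rw [hρK]; exact hc)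
  have hanti : κ τ = (κ g⁻¹)⁻¹ := hκ g⁻¹ τ ρ' hρ'r (hρ'c g⁻¹ τ hτ)
  -- `ḡ` and `τ` agree on every layer
  have hcvv : ρ.restrictNormal K • v = c • v := by rw [hρK]
  have hwbar' : canonicalArtin ((c • v).adicCompletion K) wbar =
      galAdicCompletionUnitsEquiv (L := K) (ρ.restrictNormal K) hcvv
        (canonicalArtin (v.adicCompletion K) w⁻¹) := by
    rw [hwbar, map_inv, hw, ← map_inv, galAdicCompletionUnitsEquiv_globalToLocalUnits, hρK]
    congr 1
    refine Units.ext ?_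
    rw [Units.coe_map, MonoidHom.coe_coe, Units.val_inv_eq_inv_val, hk, inv_div, map_div₀,
      algEquiv_algEquiv_apply hK.1 c (π : K)]
  have hS2 : τ⁻¹ * gbar ∈ κ.kerSubgroup := by
    refine κ.mem_kerSubgroup_of_forall_mem_layerSubgroup fun n => ?_
    haveI : FiniteDimensional K (κ.layer n) := κ.finiteDimensional_layer_holds n
    haveI : IsGalois K (κ.layer n) := κ.isGalois_layer_holds n
    haveI : IsAbelianGalois K (κ.layer n) := κ.isAbelianGalois_layer n
    haveI : NumberField (κ.layer n) := NumberField.of_module_finite K _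
    refine (κ.mem_layerSubgroup_iff_forall_smul n _).mpr fun x hx => ?_
    have hx' : x ∈ conjField ρ (conjField ρ.symm (κ.layer n)) := by
      rw [conjField_conjField_symm]; exact hx
    rw [mul_smul, smul_eq_of_mem_conjField ρ (conjField ρ.symm (κ.layer n)) hcvv hwbar' hx', map_inv,
      map_inv, ← hg, ← hτ x, inv_smul_smul]
  -- (3) `κ g² = 1`
  rw [mem_kerSubgroup] at hS1 hS2 ⊢
  rw [map_mul] at hS1 hS2
  rw [map_inv, hanti, map_inv, inv_inv] at hS2
  have h3 : κ gbar = (κ g)⁻¹ := eq_inv_of_mul_eq_one_right hS1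
  rw [h3, mul_inv_eq_one] at hS2
  -- `hS2 : (κ g)⁻¹ = κ g`
  have hgg : κ g * κ g = 1 := by
    rw [show κ g * κ g = κ g * (κ g)⁻¹ by rw [hS2], mul_inv_cancel]
  have h4 : (κ g).toAdd + (κ g).toAdd = 0 := by rw [← toAdd_mul, hgg, toAdd_one]
  rw [add_self_eq_zero] at h4
  exact Multiplicative.toAdd.injective (by rw [h4, toAdd_one])

end Anticyclotomic

/-! ### §5. (i) the Frobenius degree of `θ_v(c(π)/π)` and (iii) its cyclotomic character -/

section DegreeCyclotomic

open ValuativeRel IsNonarchimedeanLocalField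

variable {K : Type} [Field K] [NumberField K] {p : ℕ} [Fact p.Prime]

/-- **(i) `deg w = h`**: `|a_v(w)|_v = exp (deg w)` (Deligne's normalisation) and `|c(π)/π|_v = exp h`.
[cite: TateCorvallis1979, (1.4.1)] -/
theorem deg_eq_of_canonicalArtin_eq (c : K ≃ₐ[ℚ] K) {v : HeightOneSpectrum (𝓞 K)} (hcv : c • v ≠ v)
    {h : ℕ} {π : 𝓞 K} (hπ : v.asIdeal ^ h = Ideal.span {π}) {k : Kˣ}
    (hk : (k : K) = c (π : K) / (π : K)) {w : WeilGroup (v.adicCompletion K)}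
    (hw : canonicalArtin (v.adicCompletion K) w = globalToLocalUnits v k) :
    WeilGroup.deg w = h := by
  have h1 := ArtinLocalGlobal.valued_artin_eq_exp_deg v
    (isLocalArtinMap_canonicalArtin_holds (v.adicCompletion K)) w
  rw [hw, val_globalToLocalUnits, Literature.NumberTheory.GaloisRepresentations.valued_algebraMap_adicCompletion, hk,
    valuation_div_eq_exp c hcv hπ] at h1
  exact_mod_cast (WithZero.exp_injective h1).symm

/-- `|p|_v = exp (-1)` at a place with `e(v|p) = 1`. [folklore] -/
private theorem valuation_natCast_eq_exp_neg_one {v : HeightOneSpectrum (𝓞 K)}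
    (hpv : ((p : ℕ) : 𝓞 K) ∈ v.asIdeal) (he : v.asIdeal.ramificationIdx (𝓞 ℚ) = 1) :
    v.valuation K (p : K) = WithZero.exp (-1 : ℤ) := by
  set v₀ : HeightOneSpectrum (𝓞 ℚ) := v.under (𝓞 ℚ) with hv₀
  haveI : v.asIdeal.LiesOver v₀.asIdeal := ⟨rfl⟩
  have hp₀ : Rat.HeightOneSpectrum.natGenerator v₀ = p :=
    LocalField.natGenerator_eq_of_natCast_mem p v₀ (LocalField.natCast_mem_under p v hpv)
  have he' : v₀.asIdeal.ramificationIdx' v.asIdeal = 1 := by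
    rw [Ideal.ramificationIdx'_eq_ramificationIdx v₀.asIdeal v.asIdeal v₀.ne_bot]; exact he
  have h1 := HeightOneSpectrum.intValuation_liesOver v₀ v (p : 𝓞 ℚ)
  rw [he', pow_one, map_natCast (algebraMap (𝓞 ℚ) (𝓞 K))] at h1
  have h2 : v₀.intValuation (p : 𝓞 ℚ) = WithZero.exp (-1 : ℤ) := by
    have := Rat.valuation_natGenerator (v := v₀)
    rwa [hp₀, Rat.valuation_natCast] at this
  rw [show (p : K) = algebraMap (𝓞 K) K (p : 𝓞 K) by rw [map_natCast],
    HeightOneSpectrum.valuation_of_algebraMap, ← h1, h2]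

/-- **(iii) the cyclotomic character of `σ = θ_v(c(π)/π)`: `ε_p(res_v σ) ≡ m (mod pⁿ)` whenever
`m π² ≡ p^{2h} (mod v^{n+2h})`**, i.e. `ε_p(σ) = p^{2h}/π²` as a `p`-adic unit.  By Serre's Theorem 2
in Deligne's normalisation (`norm_canonicalArtin_eq_cyclotomicCharacter_mul_zpow`):
`N_{K_v/ℚ_p}(a_v w) = ε_p(w) · p^{-deg w}` with `a_v w = c(π)/π`, `deg w = h`, `[K_v : ℚ_p] = 1`
and `π c(π) = p^h`; so `ε_p(w) = p^h c(π)/π = p^{2h}/π²` in `K_v = ℚ_p`.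
[cite: CasselsFrohlichANT1967, Ch. VI §3.1 Thm. 2 with §2.4] -/
theorem toZModPow_cyclotomicCharacter_eq (hK : IsImaginaryQuadratic K) {c : K ≃ₐ[ℚ] K} (hc : c ≠ 1)
    {v : HeightOneSpectrum (𝓞 K)} (hpv : ((p : ℕ) : 𝓞 K) ∈ v.asIdeal)
    (he : v.asIdeal.ramificationIdx (𝓞 ℚ) = 1) (hf : v.asIdeal.inertiaDeg (𝓞 ℚ) = 1)
    {h : ℕ} {π : 𝓞 K} (hπ : v.asIdeal ^ h = Ideal.span {π}) {k : Kˣ}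
    (hk : (k : K) = c (π : K) / (π : K)) {w : WeilGroup (v.adicCompletion K)}
    (hw : canonicalArtin (v.adicCompletion K) w = globalToLocalUnits v k) (n m : ℕ)
    (hm : (m : 𝓞 K) * π ^ 2 - (p : 𝓞 K) ^ (2 * h) ∈ v.asIdeal ^ (n + 2 * h)) :
    PadicInt.toZModPow n
        ((GaloisRep.cyclotomicCharacter K p
          (absGaloisRestrict K (v.adicCompletion K)
            (WeilGroup.toAbsGalois (v.adicCompletion K) w)) : ℤ_[p]ˣ) : ℤ_[p]) = (m : ZMod (p ^ n)) := by
  have hp : p.Prime := Fact.out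
  haveI : Algebra.IsQuadraticExtension ℚ K := ⟨hK.1⟩
  haveI : NeZero (p : K) := ⟨Nat.cast_ne_zero.mpr hp.ne_zero⟩
  haveI : CharZero (v.adicCompletion K) := LocalField.charZero_adicCompletion v
  have hval : valuation (v.adicCompletion K) (p : v.adicCompletion K) < 1 :=
    LocalField.valuation_adicCompletion_natCast_lt_one v p hpv
  letI : Algebra ℚ_[p] (v.adicCompletion K) := LocalField.adicCompletionPadicAlgebra v p hpv
  have hbij := LocalField.bijective_algebraMap_adicCompletionPadicAlgebra p v hpv he hf
  have hcv : c • v ≠ v := smul_ne_self_of_degree_one hK.1 hc he hf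
  -- Serre's Theorem 2: `N(a w) = χ · p^{-deg w}`, `deg w = h`
  have hq : residueFieldCard (v.adicCompletion K) = p ^ 1 := by
    rw [pow_one, residueFieldCard_adicCompletion_eq]
    exact absNorm_eq_of_inertiaDeg_eq_one hpv hf
  have hN := norm_canonicalArtin_eq_cyclotomicCharacter_mul_zpow p (v.adicCompletion K) hval hq w
  rw [deg_eq_of_canonicalArtin_eq c hcv hπ hk hw, hw, Nat.cast_one, one_mul] at hN
  -- global vs local cyclotomic character
  rw [cyclotomicCharacter_absGaloisRestrict K (v.adicCompletion K) p]
  generalize hχ : ((GaloisRep.cyclotomicCharacter (v.adicCompletion K) p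
    (WeilGroup.toAbsGalois (v.adicCompletion K) w) : ℤ_[p]ˣ) : ℤ_[p]) = χ at hN ⊢
  set j := algebraMap ℚ_[p] (v.adicCompletion K) with hj
  set πF : v.adicCompletion K := algebraMap K (v.adicCompletion K) (π : K) with hπF
  -- `[K_v : ℚ_p] = 1`: the norm is the inverse of `j`
  have hfin : Module.finrank ℚ_[p] (v.adicCompletion K) = 1 := by
    rw [← (LinearEquiv.ofBijective (Algebra.linearMap ℚ_[p] (v.adicCompletion K)) hbij).finrank_eq,
      Module.finrank_self]
  obtain ⟨y, hy⟩ := hbij.2 ((globalToLocalUnits v k : (v.adicCompletion K)ˣ) : v.adicCompletion K)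
  have hyN : y = (χ : ℚ_[p]) * (p : ℚ_[p]) ^ (-(h : ℤ)) := by
    rw [← hN, ← hy]
    change y = Algebra.norm ℚ_[p] (Algebra.linearMap ℚ_[p] (v.adicCompletion K) y)
    rw [Algebra.linearMap_apply, Algebra.norm_algebraMap, hfin, pow_one]
  -- hence `j χ · π² = p^{2h}` in `K_v`
  have hπ0 : (π : K) ≠ 0 := by
    intro h0
    have : π = 0 := by exact_mod_cast h0
    rw [this, Ideal.span_singleton_zero] at hπ
    exact pow_ne_zero h v.ne_bot hπ
  have hπF0 : πF ≠ 0 := by rw [hπF]; exact (map_ne_zero _).mpr hπ0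
  have hpF0 : (p : v.adicCompletion K) ≠ 0 := Nat.cast_ne_zero.mpr hp.ne_zero
  have hkF : ((globalToLocalUnits v k : (v.adicCompletion K)ˣ) : v.adicCompletion K) =
      (p : v.adicCompletion K) ^ h / πF ^ 2 := by
    rw [val_globalToLocalUnits, hk, map_div₀, ← hπF]
    have hcπ : algebraMap K (v.adicCompletion K) (c (π : K)) = (p : v.adicCompletion K) ^ h / πF := by
      rw [eq_div_iff hπF0, hπF, ← map_mul, mul_comm, mul_algEquiv_eq_pow_of_pow_eq_span hK hc hpv hf hπ,
        map_pow, map_natCast]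
    rw [hcπ, div_div, sq]
  have hjχ : j (χ : ℚ_[p]) * πF ^ 2 = (p : v.adicCompletion K) ^ (2 * h) := by
    have hph : (p : v.adicCompletion K) ^ h ≠ 0 := pow_ne_zero _ hpF0
    have h1 : j (χ : ℚ_[p]) * ((p : v.adicCompletion K) ^ h)⁻¹ = (p : v.adicCompletion K) ^ h / πF ^ 2 := by
      rw [← hkF, ← hy, hyN, map_mul, map_zpow₀, map_natCast, zpow_neg, zpow_natCast]
    calc j (χ : ℚ_[p]) * πF ^ 2
        = j (χ : ℚ_[p]) * ((p : v.adicCompletion K) ^ h)⁻¹ * (p : v.adicCompletion K) ^ h * πF ^ 2 := by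
          rw [inv_mul_cancel_right₀ hph]
      _ = (p : v.adicCompletion K) ^ h / πF ^ 2 * (p : v.adicCompletion K) ^ h * πF ^ 2 := by rw [h1]
      _ = (p : v.adicCompletion K) ^ (2 * h) := by
          rw [div_mul_eq_mul_div, div_mul_cancel₀ _ (pow_ne_zero 2 hπF0), ← pow_add, two_mul]
  -- the congruence `m π² ≡ p^{2h} (v^{n+2h})` in `K_v`: `|(m - j χ) π²|_v ≤ exp(-(n+2h))`
  have hmF : Valued.v (((m : v.adicCompletion K) - j (χ : ℚ_[p])) * πF ^ 2) ≤
      WithZero.exp (-((n + 2 * h : ℕ) : ℤ)) := by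
    have hcast : ((((m : 𝓞 K) * π ^ 2 - (p : 𝓞 K) ^ (2 * h) : 𝓞 K) : K)) =
        (m : K) * (π : K) ^ 2 - (p : K) ^ (2 * h) := by push_cast; ring
    have h1 : ((m : v.adicCompletion K) - j (χ : ℚ_[p])) * πF ^ 2 =
        algebraMap K (v.adicCompletion K) ((((m : 𝓞 K) * π ^ 2 - (p : 𝓞 K) ^ (2 * h) : 𝓞 K) : K)) := by
      rw [hcast, map_sub, map_mul, map_pow, map_pow, map_natCast, map_natCast, ← hπF, sub_mul, hjχ]
    rw [h1, Literature.NumberTheory.GaloisRepresentations.valued_algebraMap_adicCompletion, HeightOneSpectrum.valuation_of_algebraMap,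
      HeightOneSpectrum.intValuation_le_pow_iff_mem]
    exact hm
  have hπFv : Valued.v πF = WithZero.exp (-(h : ℤ)) := by
    rw [hπF, Literature.NumberTheory.GaloisRepresentations.valued_algebraMap_adicCompletion, valuation_eq_exp_neg_of_pow_eq_span hπ]
  have hpFv : Valued.v (p : v.adicCompletion K) = WithZero.exp (-1 : ℤ) := by
    rw [show (p : v.adicCompletion K) = algebraMap K (v.adicCompletion K) (p : K) by rw [map_natCast],
      Literature.NumberTheory.GaloisRepresentations.valued_algebraMap_adicCompletion, valuation_natCast_eq_exp_neg_one hpv he]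
  have hdv : Valued.v ((m : v.adicCompletion K) - j (χ : ℚ_[p])) ≤ WithZero.exp (-(n : ℤ)) := by
    rw [map_mul, map_pow, hπFv, ← WithZero.exp_nsmul] at hmF
    have hne : WithZero.exp ((2 : ℕ) • (-(h : ℤ))) ≠ 0 := WithZero.exp_ne_zero
    calc Valued.v ((m : v.adicCompletion K) - j (χ : ℚ_[p]))
        = Valued.v ((m : v.adicCompletion K) - j (χ : ℚ_[p])) * WithZero.exp ((2 : ℕ) • (-(h : ℤ))) *
            (WithZero.exp ((2 : ℕ) • (-(h : ℤ))))⁻¹ := by rw [mul_inv_cancel_right₀ hne]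
      _ ≤ WithZero.exp (-((n + 2 * h : ℕ) : ℤ)) * (WithZero.exp ((2 : ℕ) • (-(h : ℤ))))⁻¹ := by
            gcongr
      _ = WithZero.exp (-(n : ℤ)) := by
            rw [← WithZero.exp_neg, ← WithZero.exp_add]; congr 1; push_cast; ring
  -- transport to `ℤ_p`: `pⁿ ∣ χ - m`
  set d : ℤ_[p] := χ - (m : ℤ_[p]) with hd
  have hjd : j (d : ℚ_[p]) = -((m : v.adicCompletion K) - j (χ : ℚ_[p])) := by
    rw [hd, PadicInt.coe_sub, map_sub, PadicInt.coe_natCast, map_natCast, neg_sub]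
  have hdv' : Valued.v (j (d : ℚ_[p])) ≤ WithZero.exp (-(n : ℤ)) := by rw [hjd, Valuation.map_neg]; exact hdv
  have hdvd : (p : ℤ_[p]) ^ n ∣ d := by
    by_cases hd0 : d = 0
    · rw [hd0]; exact dvd_zero _
    by_contra hndvd
    -- `d = u p^t`, `t < n`
    have hspec := PadicInt.unitCoeff_spec hd0
    set t := d.valuation with ht
    have htn : t < n := by
      by_contra hle
      exact hndvd ((pow_dvd_pow _ (not_lt.mp hle)).trans ⟨_, by rw [mul_comm]; exact hspec⟩)
    -- valuation of `j d`: units of `ℤ_p` go to units of `𝒪_v`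
    have hle : ∀ a b : v.adicCompletion K,
        valuation (v.adicCompletion K) a ≤ valuation (v.adicCompletion K) b ↔ Valued.v a ≤ Valued.v b :=
      fun a b => (Valuation.vle_iff_le (valuation (v.adicCompletion K))).symm.trans
        (Valuation.vle_iff_le Valued.v)
    have hunit : ∀ u : ℤ_[p]ˣ, Valued.v (j ((u : ℤ_[p]) : ℚ_[p])) = 1 := by
      intro u
      have h1 : ∀ u : ℤ_[p]ˣ, Valued.v (j ((u : ℤ_[p]) : ℚ_[p])) ≤ 1 := by
        intro u
        rw [← (Valued.v : Valuation (v.adicCompletion K) (WithZero (Multiplicative ℤ))).map_one, ← hle,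
          (valuation (v.adicCompletion K)).map_one]
        exact LocalField.valuation_algebraMap_padicInt_le_one (K := v.adicCompletion K) (p := p) (u : ℤ_[p])
      refine le_antisymm (h1 u) ?_
      have h2 := h1 u⁻¹
      have hprod : Valued.v (j ((u : ℤ_[p]) : ℚ_[p])) * Valued.v (j ((↑(u⁻¹) : ℤ_[p]) : ℚ_[p])) = 1 := by
        rw [← map_mul, ← map_mul, ← PadicInt.coe_mul, Units.mul_inv, PadicInt.coe_one, map_one, map_one]
      calc (1 : WithZero (Multiplicative ℤ)) = _ := hprod.symm
        _ ≤ Valued.v (j ((u : ℤ_[p]) : ℚ_[p])) * 1 := by gcongr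
        _ = _ := mul_one _
    have hjdv : Valued.v (j (d : ℚ_[p])) = WithZero.exp (-(t : ℤ)) := by
      rw [hspec, PadicInt.coe_mul, map_mul, map_mul, hunit, one_mul, PadicInt.coe_pow, PadicInt.coe_natCast,
        map_pow, map_natCast, map_pow, hpFv, ← WithZero.exp_nsmul, smul_neg, nsmul_eq_mul, mul_one]
    rw [hjdv, WithZero.exp_le_exp] at hdv'
    omega
  -- conclude
  have hker : d ∈ RingHom.ker (PadicInt.toZModPow n) := by
    rw [PadicInt.ker_toZModPow, Ideal.mem_span_singleton]; exact hdvd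
  rw [RingHom.mem_ker, hd, map_sub, sub_eq_zero, map_natCast] at hker
  exact hker

end DegreeCyclotomic

/-! ### §6. Discharge of the named fact -/

section Discharge

variable (K : Type) [Field K] [NumberField K] (p : ℕ) [Fact p.Prime]

/-- **Discharge of `ZpExtension.exists_isFrobPow_mem_kerSubgroup_of_isAnticyclotomic`** (the local
norm residue symbol of `π²/p^h = π/π̄` at a split prime fixes the anticyclotomic tower; Tate,
Cassels–Fröhlich VII Prop. 6.2 with §4.2 (ii); Serre, ibid. VI §3.1 Thm. 2; Brink 2007 §II Prop. 1):
for an imaginary quadratic `K`, `p` odd, `v ∣ p` of degree one, `h ≥ 1` and `v^h = (π)`, the element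
`σ = θ_v(c(π)/π) ∈ Γ_{K_v}` — a preimage of `c(π)/π ∈ K_vˣ` under THE local Artin map of `K_v`
(Deligne's normalisation), viewed in `Γ_{K_v}` through the Weil group — (i) has Frobenius degree `h`
(`deg_eq_of_canonicalArtin_eq`), (ii) restricts into `ker κ` for every anticyclotomic `κ`
(`absGaloisRestrict_toAbsGalois_mem_kerSubgroup`), and (iii) has cyclotomic character `p^{2h}/π²`
(`toZModPow_cyclotomicCharacter_eq`).  Stated for `K : Type`, the universe of the tree's global class
field theory and of every consumer.
[cite: CasselsFrohlichANT1967, Ch. VII §6 Prop. 6.2, §4.2 (ii); Ch. VI §3.1 Thm. 2]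
[cite: Brink2007, §II Prop. 1 (p. 2130)] -/
theorem exists_isFrobPow_mem_kerSubgroup_of_isAnticyclotomic_holds :
    exists_isFrobPow_mem_kerSubgroup_of_isAnticyclotomic K p := by
  intro hK _hp2 v hpv he hf h π _hh hπ
  classical
  haveI : Algebra.IsQuadraticExtension ℚ K := ⟨hK.1⟩
  obtain ⟨c, hc⟩ := exists_algEquiv_ne_one hK.1
  have hcv : c • v ≠ v := smul_ne_self_of_degree_one hK.1 hc he hf
  -- `k = c(π)/π ∈ Kˣ` and `w ∈ W_{K_v}` with `a_v(w) = k`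
  have hπ0 : (π : K) ≠ 0 := by
    intro h0
    have : π = 0 := by exact_mod_cast h0
    rw [this, Ideal.span_singleton_zero] at hπ
    exact pow_ne_zero h v.ne_bot hπ
  set k : Kˣ := Units.mk0 (c (π : K) / (π : K))
    (div_ne_zero ((map_ne_zero c).mpr hπ0) hπ0) with hkdef
  have hk : (k : K) = c (π : K) / (π : K) := rfl
  obtain ⟨w, hw⟩ :=
    (isLocalArtinMap_canonicalArtin_holds (v.adicCompletion K)).isOpenQuotientMap_artin.surjective
      (globalToLocalUnits v k)
  refine ⟨WeilGroup.toAbsGalois (v.adicCompletion K) w, ?_, fun κ hκ => ?_, fun n m hm => ?_⟩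
  · -- (i)
    have hdeg := deg_eq_of_canonicalArtin_eq c hcv hπ hk hw
    have h1 := WeilGroup.isFrobPow_deg IsFrobPow.mul_holds w
    rwa [hdeg] at h1
  · -- (ii)
    exact absGaloisRestrict_toAbsGalois_mem_kerSubgroup hK hc κ hκ hpv he hf hπ hk hw
  · -- (iii)
    exact toZModPow_cyclotomicCharacter_eq hK hc hpv he hf hπ hk hw n m hm

end Discharge

/-! ### §7. The symbol's cyclotomic character as an algebraic number: `ε(σ)·π² = p^{2h}` through `K ↪ K_v = ℚ_p`, and its
archimedean size (appended 2026-08-28, cell `bsd-stepL`, seat `bsd-stepL-imc-p1`; consumer: the (FIX)† stub of crux 23253) -/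

section Archimedean

open ValuativeRel IsNonarchimedeanLocalField

variable {K : Type} [Field K] [NumberField K] {p : ℕ} [Fact p.Prime]

/-- **`|τ(π)|² = p^h` for every complex embedding `τ`** of the imaginary quadratic field `K`, when `v^h = (π)` at a place
`v ∋ p` of residue degree one (`φ(N x) = |φ x|²`, `N(π) = π c(π) = p^h`). [cite: NeukirchANT1999, Ch. I §3 (norms of ideals and elements)] -/
theorem norm_embedding_sq_eq_of_pow_eq_span (hK : IsImaginaryQuadratic K)
    {v : HeightOneSpectrum (𝓞 K)} (hpv : ((p : ℕ) : 𝓞 K) ∈ v.asIdeal) (hf : v.asIdeal.inertiaDeg (𝓞 ℚ) = 1)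
    {h : ℕ} {π : 𝓞 K} (hπ : v.asIdeal ^ h = Ideal.span {π}) (τ : K →+* ℂ) :
    ‖τ (π : K)‖ ^ 2 = (p : ℝ) ^ h := by
  obtain ⟨c, hc⟩ := exists_algEquiv_ne_one hK.1
  have h1 : τ (π : K) * conj (τ (π : K)) = (p : ℂ) ^ h := by
    rw [← embedding_comp_algEquiv hK hc τ (π : K), ← map_mul, mul_algEquiv_eq_pow_of_pow_eq_span hK hc hpv hf hπ,
      map_pow, map_natCast]
  have h2 : (Complex.normSq (τ (π : K)) : ℂ) = (p : ℂ) ^ h := by rw [← Complex.mul_conj, h1]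
  have h3 : Complex.normSq (τ (π : K)) = (p : ℝ) ^ h := by exact_mod_cast h2
  rw [← h3, Complex.normSq_eq_norm_sq]

/-- **The exact form of (iii): `ε_p(res_v σ) · φ(π)² = p^{2h}` in `ℚ_p` for a ring homomorphism `φ : K → ℚ_p`** (the composite of
`K → K_v` with the inverse of `ℚ_p ≃ K_v`, `[K_v : ℚ_p] = 1`), `σ = θ_v(c(π)/π)`: the identity `j(ε) π² = p^{2h}` in `K_v` behind
`toZModPow_cyclotomicCharacter_eq`, transported to `ℚ_p`. [cite: CasselsFrohlichANT1967, Ch. VI §3.1 Thm. 2 with §2.4] -/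
theorem exists_ringHom_cyclotomicCharacter_mul_sq_eq (hK : IsImaginaryQuadratic K) {c : K ≃ₐ[ℚ] K} (hc : c ≠ 1)
    {v : HeightOneSpectrum (𝓞 K)} (hpv : ((p : ℕ) : 𝓞 K) ∈ v.asIdeal)
    (he : v.asIdeal.ramificationIdx (𝓞 ℚ) = 1) (hf : v.asIdeal.inertiaDeg (𝓞 ℚ) = 1)
    {h : ℕ} {π : 𝓞 K} (hπ : v.asIdeal ^ h = Ideal.span {π}) {k : Kˣ}
    (hk : (k : K) = c (π : K) / (π : K)) {w : WeilGroup (v.adicCompletion K)}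
    (hw : canonicalArtin (v.adicCompletion K) w = globalToLocalUnits v k) :
    ∃ φ : K →+* ℚ_[p],
      (((GaloisRep.cyclotomicCharacter K p
          (absGaloisRestrict K (v.adicCompletion K) (WeilGroup.toAbsGalois (v.adicCompletion K) w)) : ℤ_[p]ˣ) : ℤ_[p]) : ℚ_[p]) *
        φ (π : K) ^ 2 = (p : ℚ_[p]) ^ (2 * h) := by
  have hp : p.Prime := Fact.out
  haveI : Algebra.IsQuadraticExtension ℚ K := ⟨hK.1⟩
  haveI : NeZero (p : K) := ⟨Nat.cast_ne_zero.mpr hp.ne_zero⟩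
  haveI : CharZero (v.adicCompletion K) := LocalField.charZero_adicCompletion v
  have hval : valuation (v.adicCompletion K) (p : v.adicCompletion K) < 1 :=
    LocalField.valuation_adicCompletion_natCast_lt_one v p hpv
  letI : Algebra ℚ_[p] (v.adicCompletion K) := LocalField.adicCompletionPadicAlgebra v p hpv
  have hbij := LocalField.bijective_algebraMap_adicCompletionPadicAlgebra p v hpv he hf
  have hcv : c • v ≠ v := smul_ne_self_of_degree_one hK.1 hc he hf
  -- Serre's Theorem 2: `N(a w) = χ · p^{-deg w}`, `deg w = h`
  have hq : residueFieldCard (v.adicCompletion K) = p ^ 1 := by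
    rw [pow_one, residueFieldCard_adicCompletion_eq]
    exact absNorm_eq_of_inertiaDeg_eq_one hpv hf
  have hN := norm_canonicalArtin_eq_cyclotomicCharacter_mul_zpow p (v.adicCompletion K) hval hq w
  rw [deg_eq_of_canonicalArtin_eq c hcv hπ hk hw, hw, Nat.cast_one, one_mul] at hN
  -- global vs local cyclotomic character
  rw [cyclotomicCharacter_absGaloisRestrict K (v.adicCompletion K) p]
  generalize hχ : ((GaloisRep.cyclotomicCharacter (v.adicCompletion K) p
    (WeilGroup.toAbsGalois (v.adicCompletion K) w) : ℤ_[p]ˣ) : ℤ_[p]) = χ at hN ⊢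
  set j := algebraMap ℚ_[p] (v.adicCompletion K) with hj
  set πF : v.adicCompletion K := algebraMap K (v.adicCompletion K) (π : K) with hπF
  have hfin : Module.finrank ℚ_[p] (v.adicCompletion K) = 1 := by
    rw [← (LinearEquiv.ofBijective (Algebra.linearMap ℚ_[p] (v.adicCompletion K)) hbij).finrank_eq,
      Module.finrank_self]
  obtain ⟨y, hy⟩ := hbij.2 ((globalToLocalUnits v k : (v.adicCompletion K)ˣ) : v.adicCompletion K)
  have hyN : y = (χ : ℚ_[p]) * (p : ℚ_[p]) ^ (-(h : ℤ)) := by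
    rw [← hN, ← hy]
    change y = Algebra.norm ℚ_[p] (Algebra.linearMap ℚ_[p] (v.adicCompletion K) y)
    rw [Algebra.linearMap_apply, Algebra.norm_algebraMap, hfin, pow_one]
  have hπ0 : (π : K) ≠ 0 := by
    intro h0
    have : π = 0 := by exact_mod_cast h0
    rw [this, Ideal.span_singleton_zero] at hπ
    exact pow_ne_zero h v.ne_bot hπ
  have hπF0 : πF ≠ 0 := by rw [hπF]; exact (map_ne_zero _).mpr hπ0
  have hpF0 : (p : v.adicCompletion K) ≠ 0 := Nat.cast_ne_zero.mpr hp.ne_zero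
  have hkF : ((globalToLocalUnits v k : (v.adicCompletion K)ˣ) : v.adicCompletion K) =
      (p : v.adicCompletion K) ^ h / πF ^ 2 := by
    rw [val_globalToLocalUnits, hk, map_div₀, ← hπF]
    have hcπ : algebraMap K (v.adicCompletion K) (c (π : K)) = (p : v.adicCompletion K) ^ h / πF := by
      rw [eq_div_iff hπF0, hπF, ← map_mul, mul_comm, mul_algEquiv_eq_pow_of_pow_eq_span hK hc hpv hf hπ,
        map_pow, map_natCast]
    rw [hcπ, div_div, sq]
  have hjχ : j (χ : ℚ_[p]) * πF ^ 2 = (p : v.adicCompletion K) ^ (2 * h) := by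
    have hph : (p : v.adicCompletion K) ^ h ≠ 0 := pow_ne_zero _ hpF0
    have h1 : j (χ : ℚ_[p]) * ((p : v.adicCompletion K) ^ h)⁻¹ = (p : v.adicCompletion K) ^ h / πF ^ 2 := by
      rw [← hkF, ← hy, hyN, map_mul, map_zpow₀, map_natCast, zpow_neg, zpow_natCast]
    calc j (χ : ℚ_[p]) * πF ^ 2
        = j (χ : ℚ_[p]) * ((p : v.adicCompletion K) ^ h)⁻¹ * (p : v.adicCompletion K) ^ h * πF ^ 2 := by
          rw [inv_mul_cancel_right₀ hph]
      _ = (p : v.adicCompletion K) ^ h / πF ^ 2 * (p : v.adicCompletion K) ^ h * πF ^ 2 := by rw [h1]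
      _ = (p : v.adicCompletion K) ^ (2 * h) := by
          rw [div_mul_eq_mul_div, div_mul_cancel₀ _ (pow_ne_zero 2 hπF0), ← pow_add, two_mul]
  -- transport along `e : ℚ_p ≃ K_v`
  let e : ℚ_[p] ≃+* v.adicCompletion K := RingEquiv.ofBijective (algebraMap ℚ_[p] (v.adicCompletion K)) hbij
  have he_apply : ∀ x, e x = j x := fun x ↦ rfl
  refine ⟨e.symm.toRingHom.comp (algebraMap K (v.adicCompletion K)), ?_⟩
  apply e.injective
  change e ((χ : ℚ_[p]) * (e.symm πF) ^ 2) = e ((p : ℚ_[p]) ^ (2 * h))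
  rw [map_mul, map_pow, e.apply_symm_apply, map_pow, map_natCast, he_apply, hjχ]

variable (K p) in
/-- **The local symbol of `π̄/π` with its cyclotomic character as an algebraic number** — the data of
`exists_isFrobPow_mem_kerSubgroup_of_isAnticyclotomic_holds` in EXACT form: for `K` imaginary quadratic, `v ∣ p` of degree one
and `v^h = (π)` (any `p`, any `h`), there is `σ ∈ Γ_{K_v}` of Frobenius degree `h`, restricting into `ker κ` for every anticyclotomic `κ`, and a
ring homomorphism `φ : K → ℚ_p` with `ε_p(res_v σ) · φ(π)² = p^{2h}`; moreover `|τ(π)|² = p^h` for every `τ : K → ℂ`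
(`norm_embedding_sq_eq_of_pow_eq_span`). [cite: CasselsFrohlichANT1967, Ch. VII §6 Prop. 6.2, §4.2 (ii); Ch. VI §3.1 Thm. 2]
[cite: Brink2007, §II Prop. 1 (p. 2130)] -/
theorem exists_isFrobPow_mem_kerSubgroup_cyclotomicCharacter_mul_sq_eq (hK : IsImaginaryQuadratic K)
    (v : HeightOneSpectrum (𝓞 K)) (hpv : ((p : ℕ) : 𝓞 K) ∈ v.asIdeal)
    (he : v.asIdeal.ramificationIdx (𝓞 ℚ) = 1) (hf : v.asIdeal.inertiaDeg (𝓞 ℚ) = 1)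
    (h : ℕ) (π : 𝓞 K) (hπ : v.asIdeal ^ h = Ideal.span {π}) :
    ∃ σ : absoluteGaloisGroup (v.adicCompletion K),
      IsFrobPow σ (h : ℤ) ∧
      (∀ κ : ZpExtension K p, κ.IsAnticyclotomic → absGaloisRestrict K (v.adicCompletion K) σ ∈ κ.kerSubgroup) ∧
      ∃ φ : K →+* ℚ_[p],
        (((GaloisRep.cyclotomicCharacter K p (absGaloisRestrict K (v.adicCompletion K) σ) : ℤ_[p]ˣ) : ℤ_[p]) : ℚ_[p]) *
          φ (π : K) ^ 2 = (p : ℚ_[p]) ^ (2 * h) := by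
  classical
  haveI : Algebra.IsQuadraticExtension ℚ K := ⟨hK.1⟩
  obtain ⟨c, hc⟩ := exists_algEquiv_ne_one hK.1
  have hcv : c • v ≠ v := smul_ne_self_of_degree_one hK.1 hc he hf
  have hπ0 : (π : K) ≠ 0 := by
    intro h0
    have : π = 0 := by exact_mod_cast h0
    rw [this, Ideal.span_singleton_zero] at hπ
    exact pow_ne_zero h v.ne_bot hπ
  set k : Kˣ := Units.mk0 (c (π : K) / (π : K))
    (div_ne_zero ((map_ne_zero c).mpr hπ0) hπ0) with hkdef
  have hk : (k : K) = c (π : K) / (π : K) := rfl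
  obtain ⟨w, hw⟩ :=
    (isLocalArtinMap_canonicalArtin_holds (v.adicCompletion K)).isOpenQuotientMap_artin.surjective
      (globalToLocalUnits v k)
  refine ⟨WeilGroup.toAbsGalois (v.adicCompletion K) w, ?_, fun κ hκ => ?_, ?_⟩
  · have hdeg := deg_eq_of_canonicalArtin_eq c hcv hπ hk hw
    have h1 := WeilGroup.isFrobPow_deg IsFrobPow.mul_holds w
    rwa [hdeg] at h1
  · exact absGaloisRestrict_toAbsGalois_mem_kerSubgroup hK hc κ hκ hpv he hf hπ hk hw
  · exact exists_ringHom_cyclotomicCharacter_mul_sq_eq hK hc hpv he hf hπ hk hw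

end Archimedean


end Literature.NumberTheory.EllipticCurves.ZpExtension

end
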